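import Mathlib.Tactic.Ring
import Mathlib.Tactic.Linarith
import Mathlib.Tactic.Positivity
import Mathlib.Tactic.LinearCombination
import Mathlib.Data.Real.Basic
import Mathlib.Analysis.Real.Sqrt
import Summits.HodgeConjecture.HodgeConjecture.Theorems.WeilClassTestFormatFourTwoSlopes
import Summits.HodgeConjecture.HodgeConjecture.Theorems.WeilClassTestFormatFourTwoSorted
import HarnessLib

/-!
# Conjecture N in format (4,2), SHARP FORM — part 2/2: `Q₂ + λQ₄ ≥ 0` for `0 ≤ λ ≤ 3 + 2√3` (hodge-weil ladder, GAPS G51b/G51c)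

Prover 2, generation 14 (note `run/shared/lean/b2b/hodge-weil/b2b-hweil-pv2-g14/THREE-PHASE-G14.md`). THEOREM (`conjectureN_42_lambda`):
for every real (4,2) configuration that is centred, pure (P1, P2, P4) and pairwise ample at scale one (setting of `CONJECTURE-N.md` §1 /
`WeilClassTestFormatFourTwo.lean`) and every `λ ≥ 0` with `λ² ≤ 6λ + 3` (i.e. `λ ≤ 3 + 2√3`):  `Q₂ + λ·Q₄ ≥ 0`.
COROLLARIES: `conjectureN_42_sharp` (`λ = 3 + 2√3`: `Q₂ + (3 + 2√3)Q₄ ≥ 0`, i.e. `−Q₄/Q₂ ≤ 2/√3 − 1` whenever `Q₂ > 0` — the exact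
value `R = 2/√3 − 1` of pv2-g9's (4,2) cross maximiser, `CONJECTURE-N.md` §4, so the constant is sharp) and `conjectureN_42_fourThirds`
(`λ = 4/3`, the input of the three-phase reduction of the complex-charge conjecture, `WeilClassTestFormatFourTwoComplex.lean`).
Proof: pv2-g13's case analysis verbatim — one-sided F-root: part 1 (`one_sided_lambda`, slopes); otherwise `K > 0` and the
no-between patterns are impossible (pv2-g13), `K = 0` gives `Q₄ = 0 ≤ Q₂ = G₀`, and in the pattern `E F E E F E` both `Q₂ ≥ 0` and
`Q₄ ≥ 0` (`Q2_Q4_nonneg_pattern_EFEEFE`, the three-line inequality of pv2-g13 read for `Q₂` and `Q₄` separately). The sorting is removed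
by the `S₄ × S₂` symmetry as in pv2-g13's part 4. Pure algebra; nothing here is a case of HC, a rung or a door edge (C22); no statement
of Markman's papers is used. New cell result ⇒ Summits/.
-/

set_option linter.dupNamespace false

namespace Summit.HodgeConjecture.HodgeConjecture.WeilClassTestFormatFourTwoLambda

open Summit.HodgeConjecture.HodgeConjecture.WeilClassTestProductFormula
open Summit.HodgeConjecture.HodgeConjecture.WeilClassTestFormatFourTwo

/-- PATTERN `E F E E F E` (`u₁ < v₁ < u₂, u₃ < v₂ < u₄`): `Q₂ ≥ 0` AND `Q₄ ≥ 0` separately (pv2-g13's `G0_nonneg_pattern_EFEEFE`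
proves `K₂ ≥ 0` and `−K₀ ≥ 0`; on the pure locus `Q₂ = 2K₂`, `Q₄ = −12K₀`). -/
theorem Q2_Q4_nonneg_pattern_EFEEFE (A₁ A₂ A₃ A₄ B₁ B₂ u₁ u₂ u₃ u₄ v₁ v₂ : ℝ)
    (hA : A₁ + A₂ + A₃ + A₄ = B₁ + B₂) (hC : u₁ + u₂ + u₃ + u₄ = v₁ + v₂)
    (hP1 : (A₁ ^ 2 * u₁ + A₂ ^ 2 * u₂ + A₃ ^ 2 * u₃ + A₄ ^ 2 * u₄) - (B₁ ^ 2 * v₁ + B₂ ^ 2 * v₂) = 0)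
    (hP2 : (A₁ * u₁ ^ 2 + A₂ * u₂ ^ 2 + A₃ * u₃ ^ 2 + A₄ * u₄ ^ 2) - (B₁ * v₁ ^ 2 + B₂ * v₂ ^ 2) = 0)
    (hP4 : (u₁ ^ 3 + u₂ ^ 3 + u₃ ^ 3 + u₄ ^ 3) - (v₁ ^ 3 + v₂ ^ 3) = 0)
    (_m₁₁ : |u₁ - v₁| ≤ A₁ - B₁) (m₂₁ : |u₂ - v₁| ≤ A₂ - B₁) (m₃₁ : |u₃ - v₁| ≤ A₃ - B₁) (m₄₁ : |u₄ - v₁| ≤ A₄ - B₁)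
    (m₁₂ : |u₁ - v₂| ≤ A₁ - B₂) (m₂₂ : |u₂ - v₂| ≤ A₂ - B₂) (m₃₂ : |u₃ - v₂| ≤ A₃ - B₂) (_m₄₂ : |u₄ - v₂| ≤ A₄ - B₂)
    (c₁ : u₁ < v₁) (c₂ : v₁ < u₂) (c₃ : v₁ < u₃)
    (d₂ : u₂ < v₂) (d₃ : u₃ < v₂) (d₄ : v₂ < u₄) :
    (0 ≤ (1 / 2) * ((A₁ ^ 2 + A₂ ^ 2 + A₃ ^ 2 + A₄ ^ 2) - (B₁ ^ 2 + B₂ ^ 2)) * ((u₁ ^ 2 + u₂ ^ 2 + u₃ ^ 2 + u₄ ^ 2) - (v₁ ^ 2 + v₂ ^ 2))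
        + ((A₁ * u₁ + A₂ * u₂ + A₃ * u₃ + A₄ * u₄) - (B₁ * v₁ + B₂ * v₂)) ^ 2
        - 3 * ((A₁ ^ 2 * u₁ ^ 2 + A₂ ^ 2 * u₂ ^ 2 + A₃ ^ 2 * u₃ ^ 2 + A₄ ^ 2 * u₄ ^ 2) - (B₁ ^ 2 * v₁ ^ 2 + B₂ ^ 2 * v₂ ^ 2)))
    ∧ (0 ≤ 3 * ((u₁ ^ 4 + u₂ ^ 4 + u₃ ^ 4 + u₄ ^ 4) - (v₁ ^ 4 + v₂ ^ 4)) - (3 / 2) * ((u₁ ^ 2 + u₂ ^ 2 + u₃ ^ 2 + u₄ ^ 2) - (v₁ ^ 2 + v₂ ^ 2)) ^ 2) := by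
  have ha₂ : 0 ≤ A₂ - B₁ := le_trans (abs_nonneg _) m₂₁
  have ha₃ : 0 ≤ A₃ - B₁ := le_trans (abs_nonneg _) m₃₁
  have ha₄ : 0 ≤ A₄ - B₁ := le_trans (abs_nonneg _) m₄₁
  have ha₁' : 0 ≤ A₁ - B₂ := le_trans (abs_nonneg _) m₁₂
  have ha₂' : 0 ≤ A₂ - B₂ := le_trans (abs_nonneg _) m₂₂
  have ha₃' : 0 ≤ A₃ - B₂ := le_trans (abs_nonneg _) m₃₂
  have hQ2 := Q2_eq_F1 A₁ A₂ A₃ A₄ B₁ B₂ u₁ u₂ u₃ u₄ v₁ v₂ hA hC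
  have hQ4 := Q4_eq_F1 u₁ u₂ u₃ u₄ v₁ v₂ hC
  have hQ2' := Q2_eq_F2 A₁ A₂ A₃ A₄ B₁ B₂ u₁ u₂ u₃ u₄ v₁ v₂ hA hC
  have hQ4' := Q4_eq_F2 u₁ u₂ u₃ u₄ v₁ v₂ hC
  have hK1 := K1_F1_sub_K1_F2 A₁ A₂ A₃ A₄ B₁ B₂ u₁ u₂ u₃ u₄ v₁ v₂ hA hC
  rw [hP1, hP2] at hQ2 hQ2'
  rw [hP2, hP4] at hK1
  rw [hP4] at hQ4 hQ4'
  have hB : 0 ≤ (v₁ - u₁) * ((u₂ - v₁) * (u₃ - v₁) * (u₄ - v₁)) := by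
    have : 0 < (u₂ - v₁) * (u₃ - v₁) * (u₄ - v₁) := by
      have h23 : 0 < (u₂ - v₁) * (u₃ - v₁) := mul_pos (by linarith) (by linarith)
      exact mul_pos h23 (by linarith)
    exact mul_nonneg (by linarith) this.le
  refine ⟨?_, ?_⟩
  swap
  · -- Q₄ = −12K₀ = 12·(v₁ − u₁)·B ≥ 0
    rw [hQ4]
    have key : 0 ≤ 12 * ((v₁ - u₁) * ((u₂ - v₁) * (u₃ - v₁) * (u₄ - v₁))) := by linarith [hB]
    convert key using 1
    ring
  by_cases hbr : (v₁ - u₁) * ((A₄ - B₁) * (u₂ - v₁) * (u₃ - v₁) + (A₃ - B₁) * (u₂ - v₁) * (u₄ - v₁) + (A₂ - B₁) * (u₃ - v₁) * (u₄ - v₁))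
      ≤ (A₁ - B₁) * ((u₂ - v₁) * (u₃ - v₁) * (u₄ - v₁))
  · -- branch K₁(F₁) ≥ 0: K₂(F₁) ≥ 0 from F₁
    have hK2 := aX_sub_uW_nonneg (A₁ - B₁) (A₂ - B₁) (A₃ - B₁) (A₄ - B₁) (v₁ - u₁) (u₂ - v₁) (u₃ - v₁) (u₄ - v₁)
      (by linarith) (by linarith) (by linarith) (by linarith) ha₂ ha₃ ha₄ hbr
    have key : 0 ≤ 2 * ((A₁ - B₁) * ((A₄ - B₁) * (u₂ - v₁) * (u₃ - v₁) + (A₃ - B₁) * (u₂ - v₁) * (u₄ - v₁) + (A₂ - B₁) * (u₃ - v₁) * (u₄ - v₁))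
        - (v₁ - u₁) * ((A₃ - B₁) * (A₄ - B₁) * (u₂ - v₁) + (A₂ - B₁) * (A₄ - B₁) * (u₃ - v₁) + (A₂ - B₁) * (A₃ - B₁) * (u₄ - v₁))) := by
      linarith [hK2]
    rw [hQ2]
    convert key using 1
    ring
  · -- branch K₁(F₁) < 0: then K₁(F₂) < 0 and K₂(F₂) ≥ 0 from F₂
    push Not at hbr
    have e1 : (A₁ - B₁) * (u₂ - v₁) * (u₃ - v₁) * (u₄ - v₁)
      + (A₂ - B₁) * (u₁ - v₁) * (u₃ - v₁) * (u₄ - v₁)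
      + (A₃ - B₁) * (u₁ - v₁) * (u₂ - v₁) * (u₄ - v₁)
      + (A₄ - B₁) * (u₁ - v₁) * (u₂ - v₁) * (u₃ - v₁)
        = (A₁ - B₁) * ((u₂ - v₁) * (u₃ - v₁) * (u₄ - v₁))
          - (v₁ - u₁) * ((A₄ - B₁) * (u₂ - v₁) * (u₃ - v₁) + (A₃ - B₁) * (u₂ - v₁) * (u₄ - v₁) + (A₂ - B₁) * (u₃ - v₁) * (u₄ - v₁)) := by
      ring
    have e2 : (A₁ - B₂) * (u₂ - v₂) * (u₃ - v₂) * (u₄ - v₂)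
      + (A₂ - B₂) * (u₁ - v₂) * (u₃ - v₂) * (u₄ - v₂)
      + (A₃ - B₂) * (u₁ - v₂) * (u₂ - v₂) * (u₄ - v₂)
      + (A₄ - B₂) * (u₁ - v₂) * (u₂ - v₂) * (u₃ - v₂)
        = (u₄ - v₂) * ((A₃ - B₂) * (v₂ - u₁) * (v₂ - u₂) + (A₂ - B₂) * (v₂ - u₁) * (v₂ - u₃) + (A₁ - B₂) * (v₂ - u₂) * (v₂ - u₃))
          - (A₄ - B₂) * ((v₂ - u₁) * (v₂ - u₂) * (v₂ - u₃)) := by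
      ring
    have hbr' : (u₄ - v₂) * ((A₃ - B₂) * (v₂ - u₁) * (v₂ - u₂) + (A₂ - B₂) * (v₂ - u₁) * (v₂ - u₃) + (A₁ - B₂) * (v₂ - u₂) * (v₂ - u₃))
        ≤ (A₄ - B₂) * ((v₂ - u₁) * (v₂ - u₂) * (v₂ - u₃)) := by
      linarith [hK1, hbr, e1, e2]
    have hK2 := aX_sub_uW_nonneg (A₄ - B₂) (A₁ - B₂) (A₂ - B₂) (A₃ - B₂) (u₄ - v₂) (v₂ - u₁) (v₂ - u₂) (v₂ - u₃)
      (by linarith) (by linarith) (by linarith) (by linarith) ha₁' ha₂' ha₃' hbr'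
    have key : 0 ≤ 2 * ((A₄ - B₂) * ((A₃ - B₂) * (v₂ - u₁) * (v₂ - u₂) + (A₂ - B₂) * (v₂ - u₁) * (v₂ - u₃) + (A₁ - B₂) * (v₂ - u₂) * (v₂ - u₃))
        - (u₄ - v₂) * ((A₂ - B₂) * (A₃ - B₂) * (v₂ - u₁) + (A₁ - B₂) * (A₃ - B₂) * (v₂ - u₂) + (A₁ - B₂) * (A₂ - B₂) * (v₂ - u₃))) := by
      linarith [hK2]
    rw [hQ2']
    convert key using 1
    ring

/-- **SHARP CONJECTURE N IN FORMAT (4,2), sorted form.** Sorted E-charges `u₁ ≤ u₂ ≤ u₃ ≤ u₄`, `v₁ ≤ v₂`; centred, pure, pairwise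
ample; `0 ≤ λ`, `λ² ≤ 6λ + 3`. Then `Q₂ + λQ₄ ≥ 0`. -/
theorem conjectureN_42_lambda_sorted (A₁ A₂ A₃ A₄ B₁ B₂ u₁ u₂ u₃ u₄ v₁ v₂ : ℝ)
    (hA : A₁ + A₂ + A₃ + A₄ = B₁ + B₂) (hC : u₁ + u₂ + u₃ + u₄ = v₁ + v₂)
    (hP1 : (A₁ ^ 2 * u₁ + A₂ ^ 2 * u₂ + A₃ ^ 2 * u₃ + A₄ ^ 2 * u₄) - (B₁ ^ 2 * v₁ + B₂ ^ 2 * v₂) = 0)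
    (hP2 : (A₁ * u₁ ^ 2 + A₂ * u₂ ^ 2 + A₃ * u₃ ^ 2 + A₄ * u₄ ^ 2) - (B₁ * v₁ ^ 2 + B₂ * v₂ ^ 2) = 0)
    (hP4 : (u₁ ^ 3 + u₂ ^ 3 + u₃ ^ 3 + u₄ ^ 3) - (v₁ ^ 3 + v₂ ^ 3) = 0)
    (m₁₁ : |u₁ - v₁| ≤ A₁ - B₁) (m₂₁ : |u₂ - v₁| ≤ A₂ - B₁) (m₃₁ : |u₃ - v₁| ≤ A₃ - B₁) (m₄₁ : |u₄ - v₁| ≤ A₄ - B₁)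
    (m₁₂ : |u₁ - v₂| ≤ A₁ - B₂) (m₂₂ : |u₂ - v₂| ≤ A₂ - B₂) (m₃₂ : |u₃ - v₂| ≤ A₃ - B₂) (m₄₂ : |u₄ - v₂| ≤ A₄ - B₂)
    (o₁₂ : u₁ ≤ u₂) (o₂₃ : u₂ ≤ u₃) (o₃₄ : u₃ ≤ u₄) (ov : v₁ ≤ v₂)
    (l : ℝ) (hl : 0 ≤ l) (hl' : l ^ 2 ≤ 6 * l + 3) :
    0 ≤ (1 / 2) * ((A₁ ^ 2 + A₂ ^ 2 + A₃ ^ 2 + A₄ ^ 2) - (B₁ ^ 2 + B₂ ^ 2)) * ((u₁ ^ 2 + u₂ ^ 2 + u₃ ^ 2 + u₄ ^ 2) - (v₁ ^ 2 + v₂ ^ 2))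
        + ((A₁ * u₁ + A₂ * u₂ + A₃ * u₃ + A₄ * u₄) - (B₁ * v₁ + B₂ * v₂)) ^ 2
        - 3 * ((A₁ ^ 2 * u₁ ^ 2 + A₂ ^ 2 * u₂ ^ 2 + A₃ ^ 2 * u₃ ^ 2 + A₄ ^ 2 * u₄ ^ 2) - (B₁ ^ 2 * v₁ ^ 2 + B₂ ^ 2 * v₂ ^ 2))
      + l * (3 * ((u₁ ^ 4 + u₂ ^ 4 + u₃ ^ 4 + u₄ ^ 4) - (v₁ ^ 4 + v₂ ^ 4)) - (3 / 2) * ((u₁ ^ 2 + u₂ ^ 2 + u₃ ^ 2 + u₄ ^ 2) - (v₁ ^ 2 + v₂ ^ 2)) ^ 2) := by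
  by_cases hlo : v₁ ≤ u₁
  · exact one_sided_lambda A₁ A₂ A₃ A₄ B₁ B₂ u₁ u₂ u₃ u₄ v₁ v₂ hA hC hP1 hP2 hP4 m₁₁ m₂₁ m₃₁ m₄₁ m₁₂ m₂₂ m₃₂ m₄₂ o₁₂ o₂₃ o₃₄ ov hlo l hl'
  by_cases hhi : u₄ ≤ v₂
  · -- reflect: charges ↦ −charges, E-order reversed, F-roots swapped; then F₁ (was F₂) is below all E-charges
    have h := one_sided_lambda A₄ A₃ A₂ A₁ B₂ B₁ (-u₄) (-u₃) (-u₂) (-u₁) (-v₂) (-v₁)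
      (by linarith) (by linarith) (by linear_combination -hP1) (by linear_combination hP2) (by linear_combination -hP4)
      (by rw [show -u₄ - -v₂ = -(u₄ - v₂) by ring, abs_neg]; exact m₄₂)
      (by rw [show -u₃ - -v₂ = -(u₃ - v₂) by ring, abs_neg]; exact m₃₂)
      (by rw [show -u₂ - -v₂ = -(u₂ - v₂) by ring, abs_neg]; exact m₂₂)
      (by rw [show -u₁ - -v₂ = -(u₁ - v₂) by ring, abs_neg]; exact m₁₂)
      (by rw [show -u₄ - -v₁ = -(u₄ - v₁) by ring, abs_neg]; exact m₄₁)
      (by rw [show -u₃ - -v₁ = -(u₃ - v₁) by ring, abs_neg]; exact m₃₁)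
      (by rw [show -u₂ - -v₁ = -(u₂ - v₁) by ring, abs_neg]; exact m₂₁)
      (by rw [show -u₁ - -v₁ = -(u₁ - v₁) by ring, abs_neg]; exact m₁₁)
      (by linarith) (by linarith) (by linarith) (by linarith) (by linarith) l hl'
    exact h.trans_eq (by ring)
  push Not at hlo hhi
  rcases lt_trichotomy ((u₁ - v₁) * (u₂ - v₁) * (u₃ - v₁) * (u₄ - v₁)) 0 with hK | hK | hK
  · -- K < 0
    have hb4 : 0 < u₄ - v₁ := by linarith
    have h123 : (u₁ - v₁) * (u₂ - v₁) * (u₃ - v₁) < 0 := by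
      by_contra h
      push Not at h
      have := mul_nonneg h hb4.le
      linarith
    have h23 : 0 < (u₂ - v₁) * (u₃ - v₁) := by
      by_contra h
      push Not at h
      have e : (u₁ - v₁) * (u₂ - v₁) * (u₃ - v₁) = (u₁ - v₁) * ((u₂ - v₁) * (u₃ - v₁)) := by ring
      have := mul_nonneg_of_nonpos_of_nonpos (by linarith : u₁ - v₁ ≤ 0) h
      linarith
    rcases lt_or_ge v₁ u₂ with h2 | h2
    · have hK' : (u₁ - v₂) * (u₂ - v₂) * (u₃ - v₂) * (u₄ - v₂) < 0 := by
        have h := K0_F1_sub_K0_F2 u₁ u₂ u₃ u₄ v₁ v₂ hC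
        rw [hP4] at h
        linarith
      have hb4' : 0 < u₄ - v₂ := by linarith
      have h123' : (u₁ - v₂) * (u₂ - v₂) * (u₃ - v₂) < 0 := by
        by_contra h
        push Not at h
        have := mul_nonneg h hb4'.le
        linarith
      have h23' : 0 < (u₂ - v₂) * (u₃ - v₂) := by
        by_contra h
        push Not at h
        have e : (u₁ - v₂) * (u₂ - v₂) * (u₃ - v₂) = (u₁ - v₂) * ((u₂ - v₂) * (u₃ - v₂)) := by ring
        have := mul_nonneg_of_nonpos_of_nonpos (by linarith : u₁ - v₂ ≤ 0) h
        linarith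
      rcases lt_or_ge u₃ v₂ with h3 | h3
      · -- pattern E F E E F E: Q₂ ≥ 0 and Q₄ ≥ 0
        obtain ⟨hq2, hq4⟩ := Q2_Q4_nonneg_pattern_EFEEFE A₁ A₂ A₃ A₄ B₁ B₂ u₁ u₂ u₃ u₄ v₁ v₂ hA hC hP1 hP2 hP4 m₁₁ m₂₁ m₃₁ m₄₁ m₁₂ m₂₂ m₃₂ m₄₂
          hlo h2 (by linarith) (by linarith) h3 hhi
        have := mul_nonneg hl hq4
        linarith
      · have hu3 : v₂ < u₃ := by
          rcases eq_or_lt_of_le h3 with g | g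
          · exfalso; rw [g, sub_self, mul_zero] at h23'; exact lt_irrefl _ h23'
          · exact g
        have hu2 : v₂ < u₂ := by
          by_contra h
          push Not at h
          have := mul_nonpos_of_nonpos_of_nonneg (by linarith : u₂ - v₂ ≤ 0) (by linarith : 0 ≤ u₃ - v₂)
          linarith
        exact (no_config_K_neg_none_between A₁ A₂ A₃ A₄ B₁ B₂ u₁ u₂ u₃ u₄ v₁ v₂ hA hC hP2 hP4 m₁₁ m₂₁ m₃₁ m₄₁ m₁₂ m₂₂ m₃₂ m₄₂ hK
          (mul_pos_of_neg_of_neg (by linarith) (by linarith)) (mul_pos (by linarith) (by linarith))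
          (mul_pos (by linarith) (by linarith)) (mul_pos (by linarith) (by linarith))).elim
    · have hu2 : u₂ < v₁ := by
        rcases eq_or_lt_of_le h2 with g | g
        · exfalso; rw [← g, sub_self, zero_mul] at h23; exact lt_irrefl _ h23
        · exact g
      have hu3 : u₃ < v₁ := by
        by_contra h
        push Not at h
        have := mul_nonpos_of_nonpos_of_nonneg (by linarith : u₂ - v₁ ≤ 0) (by linarith : 0 ≤ u₃ - v₁)
        linarith
      exact (no_config_K_neg_none_between A₁ A₂ A₃ A₄ B₁ B₂ u₁ u₂ u₃ u₄ v₁ v₂ hA hC hP2 hP4 m₁₁ m₂₁ m₃₁ m₄₁ m₁₂ m₂₂ m₃₂ m₄₂ hK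
        (mul_pos_of_neg_of_neg (by linarith) (by linarith)) (mul_pos_of_neg_of_neg (by linarith) (by linarith))
        (mul_pos_of_neg_of_neg (by linarith) (by linarith)) (mul_pos (by linarith) (by linarith))).elim
  · -- K = 0: Q₄ = 0 and Q₂ = G₀ ≥ 0
    have hG := G0_nonneg_K0 A₁ A₂ A₃ A₄ B₁ B₂ u₁ u₂ u₃ u₄ v₁ v₂ hA hC hP1 hP2 hP4 m₂₁ m₃₁ m₂₂ m₃₂ o₂₃ ov hlo hhi hK
    have hQ4 := Q4_eq_F1 u₁ u₂ u₃ u₄ v₁ v₂ hC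
    rw [hP4, hK] at hQ4
    have hq4 : 3 * ((u₁ ^ 4 + u₂ ^ 4 + u₃ ^ 4 + u₄ ^ 4) - (v₁ ^ 4 + v₂ ^ 4)) - (3 / 2) * ((u₁ ^ 2 + u₂ ^ 2 + u₃ ^ 2 + u₄ ^ 2) - (v₁ ^ 2 + v₂ ^ 2)) ^ 2 = 0 := by
      rw [hQ4]; ring
    rw [hq4] at hG ⊢
    simpa using hG
  · -- K > 0: impossible
    exact (no_config_K_pos_split A₁ A₂ A₃ A₄ B₁ B₂ u₁ u₂ u₃ u₄ v₁ v₂ hA hC hP2 hP4 m₁₁ m₂₁ m₃₁ m₄₁ m₁₂ m₂₂ m₃₂ m₄₂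
      o₁₂ (by linarith) (by linarith) o₃₄ ov hlo hhi hK).elim


/-- Sorting step: `u₁ ≤ u₂ ≤ u₃`, `v₁ ≤ v₂`, `u₄` arbitrary. -/
theorem conjectureN_42_lambda_sorted3 (A₁ A₂ A₃ A₄ B₁ B₂ u₁ u₂ u₃ u₄ v₁ v₂ : ℝ)
    (hA : A₁ + A₂ + A₃ + A₄ = B₁ + B₂) (hC : u₁ + u₂ + u₃ + u₄ = v₁ + v₂)
    (hP1 : (A₁ ^ 2 * u₁ + A₂ ^ 2 * u₂ + A₃ ^ 2 * u₃ + A₄ ^ 2 * u₄) - (B₁ ^ 2 * v₁ + B₂ ^ 2 * v₂) = 0)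
    (hP2 : (A₁ * u₁ ^ 2 + A₂ * u₂ ^ 2 + A₃ * u₃ ^ 2 + A₄ * u₄ ^ 2) - (B₁ * v₁ ^ 2 + B₂ * v₂ ^ 2) = 0)
    (hP4 : (u₁ ^ 3 + u₂ ^ 3 + u₃ ^ 3 + u₄ ^ 3) - (v₁ ^ 3 + v₂ ^ 3) = 0)
    (m₁₁ : |u₁ - v₁| ≤ A₁ - B₁) (m₂₁ : |u₂ - v₁| ≤ A₂ - B₁) (m₃₁ : |u₃ - v₁| ≤ A₃ - B₁) (m₄₁ : |u₄ - v₁| ≤ A₄ - B₁)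
    (m₁₂ : |u₁ - v₂| ≤ A₁ - B₂) (m₂₂ : |u₂ - v₂| ≤ A₂ - B₂) (m₃₂ : |u₃ - v₂| ≤ A₃ - B₂) (m₄₂ : |u₄ - v₂| ≤ A₄ - B₂)
    (o₁₂ : u₁ ≤ u₂) (o₂₃ : u₂ ≤ u₃) (ov : v₁ ≤ v₂) (l : ℝ) (hl : 0 ≤ l) (hl' : l ^ 2 ≤ 6 * l + 3) :
    0 ≤ (1 / 2) * ((A₁ ^ 2 + A₂ ^ 2 + A₃ ^ 2 + A₄ ^ 2) - (B₁ ^ 2 + B₂ ^ 2)) * ((u₁ ^ 2 + u₂ ^ 2 + u₃ ^ 2 + u₄ ^ 2) - (v₁ ^ 2 + v₂ ^ 2))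
        + ((A₁ * u₁ + A₂ * u₂ + A₃ * u₃ + A₄ * u₄) - (B₁ * v₁ + B₂ * v₂)) ^ 2
        - 3 * ((A₁ ^ 2 * u₁ ^ 2 + A₂ ^ 2 * u₂ ^ 2 + A₃ ^ 2 * u₃ ^ 2 + A₄ ^ 2 * u₄ ^ 2) - (B₁ ^ 2 * v₁ ^ 2 + B₂ ^ 2 * v₂ ^ 2))
      + l * (3 * ((u₁ ^ 4 + u₂ ^ 4 + u₃ ^ 4 + u₄ ^ 4) - (v₁ ^ 4 + v₂ ^ 4)) - (3 / 2) * ((u₁ ^ 2 + u₂ ^ 2 + u₃ ^ 2 + u₄ ^ 2) - (v₁ ^ 2 + v₂ ^ 2)) ^ 2) := by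
  rcases le_total u₃ u₄ with o₃ | o₃
  · exact conjectureN_42_lambda_sorted A₁ A₂ A₃ A₄ B₁ B₂ u₁ u₂ u₃ u₄ v₁ v₂ hA hC hP1 hP2 hP4
      m₁₁ m₂₁ m₃₁ m₄₁ m₁₂ m₂₂ m₃₂ m₄₂ o₁₂ o₂₃ o₃ ov l hl hl'
  · rcases le_total u₂ u₄ with o₂ | o₂
    · exact (conjectureN_42_lambda_sorted A₁ A₂ A₄ A₃ B₁ B₂ u₁ u₂ u₄ u₃ v₁ v₂
        (by linarith) (by linarith) (by linarith [hP1]) (by linarith [hP2]) (by linarith [hP4])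
        m₁₁ m₂₁ m₄₁ m₃₁ m₁₂ m₂₂ m₄₂ m₃₂ o₁₂ o₂ o₃ ov l hl hl').trans_eq (by ring)
    · rcases le_total u₁ u₄ with o₁ | o₁
      · exact (conjectureN_42_lambda_sorted A₁ A₄ A₂ A₃ B₁ B₂ u₁ u₄ u₂ u₃ v₁ v₂
          (by linarith) (by linarith) (by linarith [hP1]) (by linarith [hP2]) (by linarith [hP4])
          m₁₁ m₄₁ m₂₁ m₃₁ m₁₂ m₄₂ m₂₂ m₃₂ o₁ o₂ o₂₃ ov l hl hl').trans_eq (by ring)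
      · exact (conjectureN_42_lambda_sorted A₄ A₁ A₂ A₃ B₁ B₂ u₄ u₁ u₂ u₃ v₁ v₂
          (by linarith) (by linarith) (by linarith [hP1]) (by linarith [hP2]) (by linarith [hP4])
          m₄₁ m₁₁ m₂₁ m₃₁ m₄₂ m₁₂ m₂₂ m₃₂ o₁ o₁₂ o₂₃ ov l hl hl').trans_eq (by ring)

/-- Sorting step: `u₁ ≤ u₂`, `v₁ ≤ v₂`, `u₃, u₄` arbitrary. -/
theorem conjectureN_42_lambda_sorted2 (A₁ A₂ A₃ A₄ B₁ B₂ u₁ u₂ u₃ u₄ v₁ v₂ : ℝ)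
    (hA : A₁ + A₂ + A₃ + A₄ = B₁ + B₂) (hC : u₁ + u₂ + u₃ + u₄ = v₁ + v₂)
    (hP1 : (A₁ ^ 2 * u₁ + A₂ ^ 2 * u₂ + A₃ ^ 2 * u₃ + A₄ ^ 2 * u₄) - (B₁ ^ 2 * v₁ + B₂ ^ 2 * v₂) = 0)
    (hP2 : (A₁ * u₁ ^ 2 + A₂ * u₂ ^ 2 + A₃ * u₃ ^ 2 + A₄ * u₄ ^ 2) - (B₁ * v₁ ^ 2 + B₂ * v₂ ^ 2) = 0)
    (hP4 : (u₁ ^ 3 + u₂ ^ 3 + u₃ ^ 3 + u₄ ^ 3) - (v₁ ^ 3 + v₂ ^ 3) = 0)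
    (m₁₁ : |u₁ - v₁| ≤ A₁ - B₁) (m₂₁ : |u₂ - v₁| ≤ A₂ - B₁) (m₃₁ : |u₃ - v₁| ≤ A₃ - B₁) (m₄₁ : |u₄ - v₁| ≤ A₄ - B₁)
    (m₁₂ : |u₁ - v₂| ≤ A₁ - B₂) (m₂₂ : |u₂ - v₂| ≤ A₂ - B₂) (m₃₂ : |u₃ - v₂| ≤ A₃ - B₂) (m₄₂ : |u₄ - v₂| ≤ A₄ - B₂)
    (o₁₂ : u₁ ≤ u₂) (ov : v₁ ≤ v₂) (l : ℝ) (hl : 0 ≤ l) (hl' : l ^ 2 ≤ 6 * l + 3) :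
    0 ≤ (1 / 2) * ((A₁ ^ 2 + A₂ ^ 2 + A₃ ^ 2 + A₄ ^ 2) - (B₁ ^ 2 + B₂ ^ 2)) * ((u₁ ^ 2 + u₂ ^ 2 + u₃ ^ 2 + u₄ ^ 2) - (v₁ ^ 2 + v₂ ^ 2))
        + ((A₁ * u₁ + A₂ * u₂ + A₃ * u₃ + A₄ * u₄) - (B₁ * v₁ + B₂ * v₂)) ^ 2
        - 3 * ((A₁ ^ 2 * u₁ ^ 2 + A₂ ^ 2 * u₂ ^ 2 + A₃ ^ 2 * u₃ ^ 2 + A₄ ^ 2 * u₄ ^ 2) - (B₁ ^ 2 * v₁ ^ 2 + B₂ ^ 2 * v₂ ^ 2))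
      + l * (3 * ((u₁ ^ 4 + u₂ ^ 4 + u₃ ^ 4 + u₄ ^ 4) - (v₁ ^ 4 + v₂ ^ 4)) - (3 / 2) * ((u₁ ^ 2 + u₂ ^ 2 + u₃ ^ 2 + u₄ ^ 2) - (v₁ ^ 2 + v₂ ^ 2)) ^ 2) := by
  rcases le_total u₂ u₃ with o₂ | o₂
  · exact conjectureN_42_lambda_sorted3 A₁ A₂ A₃ A₄ B₁ B₂ u₁ u₂ u₃ u₄ v₁ v₂ hA hC hP1 hP2 hP4
      m₁₁ m₂₁ m₃₁ m₄₁ m₁₂ m₂₂ m₃₂ m₄₂ o₁₂ o₂ ov l hl hl'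
  · rcases le_total u₁ u₃ with o₁ | o₁
    · exact (conjectureN_42_lambda_sorted3 A₁ A₃ A₂ A₄ B₁ B₂ u₁ u₃ u₂ u₄ v₁ v₂
        (by linarith) (by linarith) (by linarith [hP1]) (by linarith [hP2]) (by linarith [hP4])
        m₁₁ m₃₁ m₂₁ m₄₁ m₁₂ m₃₂ m₂₂ m₄₂ o₁ o₂ ov l hl hl').trans_eq (by ring)
    · exact (conjectureN_42_lambda_sorted3 A₃ A₁ A₂ A₄ B₁ B₂ u₃ u₁ u₂ u₄ v₁ v₂
        (by linarith) (by linarith) (by linarith [hP1]) (by linarith [hP2]) (by linarith [hP4])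
        m₃₁ m₁₁ m₂₁ m₄₁ m₃₂ m₁₂ m₂₂ m₄₂ o₁ o₁₂ ov l hl hl').trans_eq (by ring)

/-- Sorting step: `v₁ ≤ v₂`, E-charges arbitrary. -/
theorem conjectureN_42_lambda_vsorted (A₁ A₂ A₃ A₄ B₁ B₂ u₁ u₂ u₃ u₄ v₁ v₂ : ℝ)
    (hA : A₁ + A₂ + A₃ + A₄ = B₁ + B₂) (hC : u₁ + u₂ + u₃ + u₄ = v₁ + v₂)
    (hP1 : (A₁ ^ 2 * u₁ + A₂ ^ 2 * u₂ + A₃ ^ 2 * u₃ + A₄ ^ 2 * u₄) - (B₁ ^ 2 * v₁ + B₂ ^ 2 * v₂) = 0)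
    (hP2 : (A₁ * u₁ ^ 2 + A₂ * u₂ ^ 2 + A₃ * u₃ ^ 2 + A₄ * u₄ ^ 2) - (B₁ * v₁ ^ 2 + B₂ * v₂ ^ 2) = 0)
    (hP4 : (u₁ ^ 3 + u₂ ^ 3 + u₃ ^ 3 + u₄ ^ 3) - (v₁ ^ 3 + v₂ ^ 3) = 0)
    (m₁₁ : |u₁ - v₁| ≤ A₁ - B₁) (m₂₁ : |u₂ - v₁| ≤ A₂ - B₁) (m₃₁ : |u₃ - v₁| ≤ A₃ - B₁) (m₄₁ : |u₄ - v₁| ≤ A₄ - B₁)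
    (m₁₂ : |u₁ - v₂| ≤ A₁ - B₂) (m₂₂ : |u₂ - v₂| ≤ A₂ - B₂) (m₃₂ : |u₃ - v₂| ≤ A₃ - B₂) (m₄₂ : |u₄ - v₂| ≤ A₄ - B₂)
    (ov : v₁ ≤ v₂) (l : ℝ) (hl : 0 ≤ l) (hl' : l ^ 2 ≤ 6 * l + 3) :
    0 ≤ (1 / 2) * ((A₁ ^ 2 + A₂ ^ 2 + A₃ ^ 2 + A₄ ^ 2) - (B₁ ^ 2 + B₂ ^ 2)) * ((u₁ ^ 2 + u₂ ^ 2 + u₃ ^ 2 + u₄ ^ 2) - (v₁ ^ 2 + v₂ ^ 2))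
        + ((A₁ * u₁ + A₂ * u₂ + A₃ * u₃ + A₄ * u₄) - (B₁ * v₁ + B₂ * v₂)) ^ 2
        - 3 * ((A₁ ^ 2 * u₁ ^ 2 + A₂ ^ 2 * u₂ ^ 2 + A₃ ^ 2 * u₃ ^ 2 + A₄ ^ 2 * u₄ ^ 2) - (B₁ ^ 2 * v₁ ^ 2 + B₂ ^ 2 * v₂ ^ 2))
      + l * (3 * ((u₁ ^ 4 + u₂ ^ 4 + u₃ ^ 4 + u₄ ^ 4) - (v₁ ^ 4 + v₂ ^ 4)) - (3 / 2) * ((u₁ ^ 2 + u₂ ^ 2 + u₃ ^ 2 + u₄ ^ 2) - (v₁ ^ 2 + v₂ ^ 2)) ^ 2) := by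
  rcases le_total u₁ u₂ with o₁ | o₁
  · exact conjectureN_42_lambda_sorted2 A₁ A₂ A₃ A₄ B₁ B₂ u₁ u₂ u₃ u₄ v₁ v₂ hA hC hP1 hP2 hP4
      m₁₁ m₂₁ m₃₁ m₄₁ m₁₂ m₂₂ m₃₂ m₄₂ o₁ ov l hl hl'
  · exact (conjectureN_42_lambda_sorted2 A₂ A₁ A₃ A₄ B₁ B₂ u₂ u₁ u₃ u₄ v₁ v₂
      (by linarith) (by linarith) (by linarith [hP1]) (by linarith [hP2]) (by linarith [hP4])
      m₂₁ m₁₁ m₃₁ m₄₁ m₂₂ m₁₂ m₃₂ m₄₂ o₁ ov l hl hl').trans_eq (by ring)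

/-- **SHARP CONJECTURE N IN FORMAT (4,2) (real charges).** Centred + pure (P1, P2, P4) + pairwise ample ⇒ `Q₂ + λ·Q₄ ≥ 0` for every
`λ ≥ 0` with `λ² ≤ 6λ + 3` (equivalently `λ ≤ 3 + 2√3`); `λ = 1` is pv2-g13's `conjectureN_42`, `λ = 3 + 2√3` is sharp
(pv2-g9's cross maximiser has `Q₂ + (3 + 2√3)Q₄ = 0`). -/
theorem conjectureN_42_lambda (A₁ A₂ A₃ A₄ B₁ B₂ u₁ u₂ u₃ u₄ v₁ v₂ : ℝ)
    (hA : A₁ + A₂ + A₃ + A₄ = B₁ + B₂) (hC : u₁ + u₂ + u₃ + u₄ = v₁ + v₂)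
    (hP1 : (A₁ ^ 2 * u₁ + A₂ ^ 2 * u₂ + A₃ ^ 2 * u₃ + A₄ ^ 2 * u₄) - (B₁ ^ 2 * v₁ + B₂ ^ 2 * v₂) = 0)
    (hP2 : (A₁ * u₁ ^ 2 + A₂ * u₂ ^ 2 + A₃ * u₃ ^ 2 + A₄ * u₄ ^ 2) - (B₁ * v₁ ^ 2 + B₂ * v₂ ^ 2) = 0)
    (hP4 : (u₁ ^ 3 + u₂ ^ 3 + u₃ ^ 3 + u₄ ^ 3) - (v₁ ^ 3 + v₂ ^ 3) = 0)
    (m₁₁ : |u₁ - v₁| ≤ A₁ - B₁) (m₂₁ : |u₂ - v₁| ≤ A₂ - B₁) (m₃₁ : |u₃ - v₁| ≤ A₃ - B₁) (m₄₁ : |u₄ - v₁| ≤ A₄ - B₁)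
    (m₁₂ : |u₁ - v₂| ≤ A₁ - B₂) (m₂₂ : |u₂ - v₂| ≤ A₂ - B₂) (m₃₂ : |u₃ - v₂| ≤ A₃ - B₂) (m₄₂ : |u₄ - v₂| ≤ A₄ - B₂)
    (l : ℝ) (hl : 0 ≤ l) (hl' : l ^ 2 ≤ 6 * l + 3) :
    0 ≤ (1 / 2) * ((A₁ ^ 2 + A₂ ^ 2 + A₃ ^ 2 + A₄ ^ 2) - (B₁ ^ 2 + B₂ ^ 2)) * ((u₁ ^ 2 + u₂ ^ 2 + u₃ ^ 2 + u₄ ^ 2) - (v₁ ^ 2 + v₂ ^ 2))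
        + ((A₁ * u₁ + A₂ * u₂ + A₃ * u₃ + A₄ * u₄) - (B₁ * v₁ + B₂ * v₂)) ^ 2
        - 3 * ((A₁ ^ 2 * u₁ ^ 2 + A₂ ^ 2 * u₂ ^ 2 + A₃ ^ 2 * u₃ ^ 2 + A₄ ^ 2 * u₄ ^ 2) - (B₁ ^ 2 * v₁ ^ 2 + B₂ ^ 2 * v₂ ^ 2))
      + l * (3 * ((u₁ ^ 4 + u₂ ^ 4 + u₃ ^ 4 + u₄ ^ 4) - (v₁ ^ 4 + v₂ ^ 4)) - (3 / 2) * ((u₁ ^ 2 + u₂ ^ 2 + u₃ ^ 2 + u₄ ^ 2) - (v₁ ^ 2 + v₂ ^ 2)) ^ 2) := by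
  rcases le_total v₁ v₂ with ov | ov
  · exact conjectureN_42_lambda_vsorted A₁ A₂ A₃ A₄ B₁ B₂ u₁ u₂ u₃ u₄ v₁ v₂ hA hC hP1 hP2 hP4
      m₁₁ m₂₁ m₃₁ m₄₁ m₁₂ m₂₂ m₃₂ m₄₂ ov l hl hl'
  · exact (conjectureN_42_lambda_vsorted A₁ A₂ A₃ A₄ B₂ B₁ u₁ u₂ u₃ u₄ v₂ v₁
      (by linarith) (by linarith) (by linarith [hP1]) (by linarith [hP2]) (by linarith [hP4])
      m₁₂ m₂₂ m₃₂ m₄₂ m₁₁ m₂₁ m₃₁ m₄₁ ov l hl hl').trans_eq (by ring)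

/-- **THE SHARP CONSTANT.** Centred + pure + pairwise ample real (4,2) configurations satisfy `Q₂ + (3 + 2√3)·Q₄ ≥ 0`, i.e.
`−Q₄ ≤ (2/√3 − 1)·Q₂`: the supremum `R′ = 2/√3 − 1` of `CONJECTURE-N.md` §4 / `PRODUCT-FORMULA-G13.md` §0 is a theorem (and is attained). -/
theorem conjectureN_42_sharp (A₁ A₂ A₃ A₄ B₁ B₂ u₁ u₂ u₃ u₄ v₁ v₂ : ℝ)
    (hA : A₁ + A₂ + A₃ + A₄ = B₁ + B₂) (hC : u₁ + u₂ + u₃ + u₄ = v₁ + v₂)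
    (hP1 : (A₁ ^ 2 * u₁ + A₂ ^ 2 * u₂ + A₃ ^ 2 * u₃ + A₄ ^ 2 * u₄) - (B₁ ^ 2 * v₁ + B₂ ^ 2 * v₂) = 0)
    (hP2 : (A₁ * u₁ ^ 2 + A₂ * u₂ ^ 2 + A₃ * u₃ ^ 2 + A₄ * u₄ ^ 2) - (B₁ * v₁ ^ 2 + B₂ * v₂ ^ 2) = 0)
    (hP4 : (u₁ ^ 3 + u₂ ^ 3 + u₃ ^ 3 + u₄ ^ 3) - (v₁ ^ 3 + v₂ ^ 3) = 0)
    (m₁₁ : |u₁ - v₁| ≤ A₁ - B₁) (m₂₁ : |u₂ - v₁| ≤ A₂ - B₁) (m₃₁ : |u₃ - v₁| ≤ A₃ - B₁) (m₄₁ : |u₄ - v₁| ≤ A₄ - B₁)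
    (m₁₂ : |u₁ - v₂| ≤ A₁ - B₂) (m₂₂ : |u₂ - v₂| ≤ A₂ - B₂) (m₃₂ : |u₃ - v₂| ≤ A₃ - B₂) (m₄₂ : |u₄ - v₂| ≤ A₄ - B₂)
    :
    0 ≤ (1 / 2) * ((A₁ ^ 2 + A₂ ^ 2 + A₃ ^ 2 + A₄ ^ 2) - (B₁ ^ 2 + B₂ ^ 2)) * ((u₁ ^ 2 + u₂ ^ 2 + u₃ ^ 2 + u₄ ^ 2) - (v₁ ^ 2 + v₂ ^ 2))
        + ((A₁ * u₁ + A₂ * u₂ + A₃ * u₃ + A₄ * u₄) - (B₁ * v₁ + B₂ * v₂)) ^ 2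
        - 3 * ((A₁ ^ 2 * u₁ ^ 2 + A₂ ^ 2 * u₂ ^ 2 + A₃ ^ 2 * u₃ ^ 2 + A₄ ^ 2 * u₄ ^ 2) - (B₁ ^ 2 * v₁ ^ 2 + B₂ ^ 2 * v₂ ^ 2))
      + (3 + 2 * Real.sqrt 3) * (3 * ((u₁ ^ 4 + u₂ ^ 4 + u₃ ^ 4 + u₄ ^ 4) - (v₁ ^ 4 + v₂ ^ 4)) - (3 / 2) * ((u₁ ^ 2 + u₂ ^ 2 + u₃ ^ 2 + u₄ ^ 2) - (v₁ ^ 2 + v₂ ^ 2)) ^ 2) := by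
  have h3 : Real.sqrt 3 ^ 2 = 3 := Real.sq_sqrt (by norm_num)
  have hs : 0 ≤ Real.sqrt 3 := Real.sqrt_nonneg 3
  exact conjectureN_42_lambda A₁ A₂ A₃ A₄ B₁ B₂ u₁ u₂ u₃ u₄ v₁ v₂ hA hC hP1 hP2 hP4 m₁₁ m₂₁ m₃₁ m₄₁ m₁₂ m₂₂ m₃₂ m₄₂
    (3 + 2 * Real.sqrt 3) (by linarith) (le_of_eq (by linear_combination 4 * h3))

/-- **THE CONSTANT `4/3`** (input of the three-phase reduction, `WeilClassTestFormatFourTwoComplex.lean`): `Q₂ + (4/3)·Q₄ ≥ 0`,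
i.e. `3Q₂ + 4Q₄ ≥ 0`, for centred + pure + pairwise ample real (4,2) configurations. -/
theorem conjectureN_42_fourThirds (A₁ A₂ A₃ A₄ B₁ B₂ u₁ u₂ u₃ u₄ v₁ v₂ : ℝ)
    (hA : A₁ + A₂ + A₃ + A₄ = B₁ + B₂) (hC : u₁ + u₂ + u₃ + u₄ = v₁ + v₂)
    (hP1 : (A₁ ^ 2 * u₁ + A₂ ^ 2 * u₂ + A₃ ^ 2 * u₃ + A₄ ^ 2 * u₄) - (B₁ ^ 2 * v₁ + B₂ ^ 2 * v₂) = 0)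
    (hP2 : (A₁ * u₁ ^ 2 + A₂ * u₂ ^ 2 + A₃ * u₃ ^ 2 + A₄ * u₄ ^ 2) - (B₁ * v₁ ^ 2 + B₂ * v₂ ^ 2) = 0)
    (hP4 : (u₁ ^ 3 + u₂ ^ 3 + u₃ ^ 3 + u₄ ^ 3) - (v₁ ^ 3 + v₂ ^ 3) = 0)
    (m₁₁ : |u₁ - v₁| ≤ A₁ - B₁) (m₂₁ : |u₂ - v₁| ≤ A₂ - B₁) (m₃₁ : |u₃ - v₁| ≤ A₃ - B₁) (m₄₁ : |u₄ - v₁| ≤ A₄ - B₁)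
    (m₁₂ : |u₁ - v₂| ≤ A₁ - B₂) (m₂₂ : |u₂ - v₂| ≤ A₂ - B₂) (m₃₂ : |u₃ - v₂| ≤ A₃ - B₂) (m₄₂ : |u₄ - v₂| ≤ A₄ - B₂)
    :
    0 ≤ (1 / 2) * ((A₁ ^ 2 + A₂ ^ 2 + A₃ ^ 2 + A₄ ^ 2) - (B₁ ^ 2 + B₂ ^ 2)) * ((u₁ ^ 2 + u₂ ^ 2 + u₃ ^ 2 + u₄ ^ 2) - (v₁ ^ 2 + v₂ ^ 2))
        + ((A₁ * u₁ + A₂ * u₂ + A₃ * u₃ + A₄ * u₄) - (B₁ * v₁ + B₂ * v₂)) ^ 2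
        - 3 * ((A₁ ^ 2 * u₁ ^ 2 + A₂ ^ 2 * u₂ ^ 2 + A₃ ^ 2 * u₃ ^ 2 + A₄ ^ 2 * u₄ ^ 2) - (B₁ ^ 2 * v₁ ^ 2 + B₂ ^ 2 * v₂ ^ 2))
      + (4 / 3) * (3 * ((u₁ ^ 4 + u₂ ^ 4 + u₃ ^ 4 + u₄ ^ 4) - (v₁ ^ 4 + v₂ ^ 4)) - (3 / 2) * ((u₁ ^ 2 + u₂ ^ 2 + u₃ ^ 2 + u₄ ^ 2) - (v₁ ^ 2 + v₂ ^ 2)) ^ 2) :=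
  conjectureN_42_lambda A₁ A₂ A₃ A₄ B₁ B₂ u₁ u₂ u₃ u₄ v₁ v₂ hA hC hP1 hP2 hP4 m₁₁ m₂₁ m₃₁ m₄₁ m₁₂ m₂₂ m₃₂ m₄₂ (4 / 3) (by norm_num) (by norm_num)

end Summit.HodgeConjecture.HodgeConjecture.WeilClassTestFormatFourTwoLambda
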